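import Summits.ValiantsHypothesis.ValiantsHypothesis.Theorems.MatrixDescartes.Negative.MatrixDescartesFalseOfTropicalMonster
import Summits.ValiantsHypothesis.ValiantsHypothesis.Theorems.LacunarySymmetroidMatrixDescartesStubDominantInjective
import Summits.ValiantsHypothesis.ValiantsHypothesis.Theorems.LacunarySymmetroidMatrixDescartesStubShadowEmbed
import Summits.ValiantsHypothesis.ValiantsHypothesis.Theorems.LacunarySymmetroidMatrixDescartesStubShadowTransport
import Summits.ValiantsHypothesis.ValiantsHypothesis.Theorems.LacunarySymmetroidMatrixDescartesStubShadowArith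
import Literature.Computability.AlgebraicComplexity.BirkhoffShadow

/-!
# Crux `MatrixDescartes` (stmt-ValiantsHypothesis-18050), line `Lift` — the tropical door needs
# super-quasi-polynomial Birkhoff shadows

The tree theorem `MatrixDescartes_false_of_TropicalMonster` (p164927) makes the TROPICAL door to a
refutation of the crux a kernel implication: a `TropicalMonster` — a family of K-class parametric
assignment designs of format `(m, K)`, `m ≤ 2^((⌊log₂K⌋+c)^c)`, with `B + 1` sign-alternating unique optima,
`B^q > 2^(K⌊log₂K⌋)` — refutes `MatrixDescartes` by Viro patchworking.  This file proves the converse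
direction of the NEGATION MAP: the door is at least as hard as a named open problem.

`shadowBirkhoffIO_of_tropicalMonster : TropicalMonster → ∀ c n₀, ∃ n ≥ n₀, ∃ L, 2^((⌊log₂ n⌋+c)^c) < #vert`

where `#vert` is the number of extreme points of the convex hull of the plane projection `L` of the `n × n`
permutation matrices (`Literature.Computability.AlgebraicComplexity.permMatrixPoints`, the vertex set of the
Birkhoff polytope `DS_n`): a TropicalMonster forces the shadow complexity `σ(DS_n)` above every quasi-polynomial
`2^((log n + c)^c)` for infinitely many `n` — the infinitely-often form of the sibling route item
`DivisionGap.ShadowBirkhoff` (stmt-ValiantsHypothesis-5069), i.e. of Hrubeš–Yehudayoff 2021, Open Problem 1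
(weak form; printed knowledge is `2^{Θ(log² n)} ≤ σ(DS_n) ≤ 2^{O(n)}`, tree
`HrubesYehudayoff2021_prop23_lower_holds` / `_upper`).  So the crux is boxed between two named open problems by
kernel theorems: `MatrixDescartes ⇒ VP ≠ VNP` (route assembly, 18051/18052/18055) and
`tropical ¬MatrixDescartes ⇒ super-quasi-polynomial Birkhoff shadows` (this file ∘ p164927's hypothesis).

Composition of four registered sub-goals of the line, all landed (wave 2 of lead c3):
* `stub_dominantInjective` (p168648): dominant terms at increasing slopes with alternating signs are pairwise
  distinct (dominance regions are intervals: tropical weights are affine in the slope);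
* `stub_shadowEmbed` (p169104): the embedding — node set `Fin m × Fin (K+2)` (columns, rows, ports), the
  Leibniz term `(σ, λ)` as the permutation `(i,0) ↦ (i, λ i + 2) ↦ (σ i, 1) ↦ (σ i, 0)`, pattern arcs weighted
  `(d_l, 0)`, `(0, −v)`, `(0, 0)`, every other pair penalised; a dominant term is the strict unique maximiser of
  `(x, y) ↦ θ x + y` over the projected permutation matrices, hence a vertex
  (`BirkhoffShadowLower.mem_extremePoints_convexHull_of_forall_lt`);
* `stub_shadowTransport` (p168639): relabelling the nodes (`finProdFinEquiv`) does not change the image set;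
* `stub_shadowArith` (p168739): in the regime, `B + 1 > 2^((⌊log₂(m(K+2))⌋ + c)^c)` for all large `K`.

[folklore] (embedding of assignment problems into Birkhoff shadows: Mulmuley–Shah 2001 Cor. 1.1,
Hrubeš–Yehudayoff 2021 Thm 4 / Prop. 23, here for multi-class designs).
-/

-- layout Summits/ValiantsHypothesis/ValiantsHypothesis forces the duplicated namespace component
set_option linter.dupNamespace false

namespace Summit.ValiantsHypothesis.ValiantsHypothesis.Theorems.LacunarySymmetroidMatrixDescartes

open Summit.ValiantsHypothesis.ValiantsHypothesis.Theorems.MatrixDescartes.Negative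
open Literature.Computability.AlgebraicComplexity

/-- **The tropical door needs super-quasi-polynomial Birkhoff shadows.**  A `TropicalMonster` (the
hypothesis of the tree's `MatrixDescartes_false_of_TropicalMonster`) gives, for every `c` and infinitely many
`n`, a linear plane projection of the `n × n` permutation matrices whose convex hull has more than
`2^((⌊log₂ n⌋+c)^c)` extreme points — the infinitely-often form of `DivisionGap.ShadowBirkhoff`
(Hrubeš–Yehudayoff 2021, Open Problem 1, weak form). -/
theorem shadowBirkhoffIO_of_tropicalMonster :
    Summit.ValiantsHypothesis.ValiantsHypothesis.Theorems.MatrixDescartes.Negative.TropicalMonster →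
      ∀ c n₀ : ℕ, ∃ n : ℕ, n₀ ≤ n ∧ ∃ L : (Fin n × Fin n → ℝ) →ₗ[ℝ] (Fin 2 → ℝ),
        2 ^ ((Nat.log 2 n + c) ^ c) < Set.ncard (Set.extremePoints ℝ (convexHull ℝ
          (L '' Literature.Computability.AlgebraicComplexity.permMatrixPoints n))) := by
  intro hT c n₀
  obtain ⟨c₀, q, hq, hK⟩ := hT
  obtain ⟨K₁, hK₁⟩ := stub_shadowArith c₀ q c
  obtain ⟨K, m, hKge, hm, d, v, ε, B, θ, p, _hε, hθ, hdom, halt, hB⟩ := hK (max K₁ n₀)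
  have hinj : Function.Injective p := stub_dominantInjective m K d v ε B θ p hθ hdom halt
  -- `m = 0` is impossible: there would be a single Leibniz term, so `B = 0`, contradicting `2^(K log K) < B^q`
  have hm1 : 1 ≤ m := by
    rcases Nat.eq_zero_or_pos m with h0 | h0
    · exfalso
      subst h0
      have hcard : B + 1 ≤ 1 := by
        have h := Fintype.card_le_of_injective p hinj
        simpa using h
      have hB0 : B = 0 := by omega
      subst hB0
      rw [zero_pow (Nat.pos_iff_ne_zero.1 hq)] at hB
      exact (Nat.not_lt_zero _) hB
    · exact h0
  obtain ⟨L, hL⟩ := stub_shadowEmbed m K d v ε B θ p hdom hinj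
  obtain ⟨L', hL'⟩ := stub_shadowTransport (Fin m × Fin (K + 2)) (m * (K + 2)) finProdFinEquiv L
  refine ⟨m * (K + 2), ?_, L', ?_⟩
  · calc n₀ ≤ max K₁ n₀ := le_max_right _ _
      _ ≤ K := hKge
      _ ≤ 1 * (K + 2) := by omega
      _ ≤ m * (K + 2) := Nat.mul_le_mul_right _ hm1
  · rw [hL']
    exact lt_of_lt_of_le (hK₁ K m B (le_trans (le_max_left _ _) hKge) hm hB) hL

/-- Contrapositive, consumable form: a quasi-polynomial CAP on Birkhoff shadows (for some `c`, eventually every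
plane projection of the `n × n` permutation matrices has at most `2^((⌊log₂ n⌋+c)^c)` vertices — e.g. a
Gusfield-type bound for parametric ASSIGNMENT, which is not known) closes the tropical door: no
`TropicalMonster` exists, and a refutation of `MatrixDescartes` would have to be non-tropical
(cancellation-driven). -/
theorem not_tropicalMonster_of_shadow_cap
    (hcap : ∃ c n₀ : ℕ, ∀ n : ℕ, n₀ ≤ n → ∀ L : (Fin n × Fin n → ℝ) →ₗ[ℝ] (Fin 2 → ℝ),
      Set.ncard (Set.extremePoints ℝ (convexHull ℝ (L '' permMatrixPoints n))) ≤ 2 ^ ((Nat.log 2 n + c) ^ c)) :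
    ¬ TropicalMonster := by
  intro hT
  obtain ⟨c, n₀, hcap⟩ := hcap
  obtain ⟨n, hn, L, hL⟩ := shadowBirkhoffIO_of_tropicalMonster hT c n₀
  exact absurd (hcap n hn L) (not_le.2 hL)

end Summit.ValiantsHypothesis.ValiantsHypothesis.Theorems.LacunarySymmetroidMatrixDescartes
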